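import Literature.AlgebraicGeometry.Frobenioids.DilatingMonoidExample
import HarnessLib

/-!
# Frobenioids I, §3, Example 3.7: "`Φ` clearly fails to be non-dilating" (proof)

Mochizuki, *The geometry of Frobenioids I: the general theory*, Kyushu J. Math. **62** (2008)
293–400, kurims text p. 70 [cite: MochizukiFrdI2008, Ex. 3.7 p.70].  Discharges the named statement
`Ex37.NotNonDilating` of `DilatingMonoidExample.lean`: for an arrow `f` of `D` of Frobenius degree
`d_f = 2`, the pull-back `Φ(f) : (g, a) ↦ (g, 2a)` of `G × ℤ_{≥0}` satisfies the hypothesis of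
[FrdI] Def. 1.1 (i) (`Φ(f)^char(a) ≼ a` for every `a`, with `n = 2`) but `Φ(f)^char ≠ id`
(`(0, 1) ↦ (0, 2)`, not associated since the units of `G × ℤ_{≥0}` are `G × {0}`).
-/

namespace Literature.AlgebraicGeometry.Frobenioids

open CategoryTheory

namespace Ex37

open Ex36 (G FG D)

/-- The pull-back of `Φ` along an arrow `f` of `D` is `act f`. [cite: MochizukiFrdI2008, Ex. 3.7 p.70] -/
theorem pull_Φ (f : SingleObj.star FG ⟶ SingleObj.star FG) (x : Multiplicative G × Multiplicative ℕ) :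
    pull Φ f x = act (show FG from f) x := rfl

/-- **Example 3.7**: "`Φ` clearly fails to be non-dilating" (FrdI p. 70; PROVED).
[cite: MochizukiFrdI2008, Ex. 3.7 p.70] -/
theorem notNonDilating_holds : NotNonDilating := by
  intro h
  let f : FG := ⟨1, 2⟩
  have h1 : IsNonDilating (act f) := h (SingleObj.star FG) (show SingleObj.star FG ⟶ SingleObj.star FG from f)
  have hyp : ∀ a : Associates (Multiplicative G × Multiplicative ℕ), IsPrimary a →
      associatesMap (act f) a ≼ a := by
    intro a _
    obtain ⟨x, rfl⟩ := Associates.mk_surjective a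
    refine ⟨2, two_pos, ?_⟩
    rw [associatesMap_mk, ← Associates.mk_pow, Associates.mk_dvd_mk]
    refine ⟨(x.1, 1), Prod.ext ?_ ?_⟩
    · show x.1 ^ 2 = (act f x).1 * x.1
      simp [act, pow_two]
    · show x.2 ^ 2 = (act f x).2 * 1
      simp [act, f]
  have hid := h1 hyp
  have h2 := congrArg
    (fun φ => φ (Associates.mk ((1 : Multiplicative G), Multiplicative.ofAdd (1 : ℕ)))) hid
  simp only [associatesMap_mk, MonoidHom.id_apply] at h2
  rw [Associates.mk_eq_mk_iff_associated] at h2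
  obtain ⟨u, hu⟩ := h2
  have hunit : IsUnit ((u : Multiplicative G × Multiplicative ℕ).2) :=
    (Units.isUnit u).map (MonoidHom.snd _ _)
  have hu0 : Multiplicative.toAdd ((u : Multiplicative G × Multiplicative ℕ).2) = 0 := by
    obtain ⟨v, hv⟩ := hunit
    have h3 := congrArg Multiplicative.toAdd v.mul_inv
    rw [toAdd_mul, toAdd_one] at h3
    rw [← hv]
    omega
  have hu2 : Multiplicative.toAdd ((act f (1, Multiplicative.ofAdd (1 : ℕ))).2) +
      Multiplicative.toAdd ((u : Multiplicative G × Multiplicative ℕ).2) = 1 := by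
    have := congrArg (fun z : Multiplicative G × Multiplicative ℕ => Multiplicative.toAdd z.2) hu
    simpa only [Prod.snd_mul, toAdd_mul, toAdd_ofAdd] using this
  have e1 : Multiplicative.toAdd ((act f (1, Multiplicative.ofAdd (1 : ℕ))).2) = 2 := rfl
  rw [e1, hu0] at hu2
  omega

end Ex37

end Literature.AlgebraicGeometry.Frobenioids
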